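import Summits.Ventures.CertifiedManyBodySolver.Upper.IntervalReaderChainEnergy

/-!
# Ventures/CertifiedManyBodySolver — Upper/IntervalReaderGraphEnergy.lean: `⟨ψ|H|ψ⟩` for ANY finite graph IS a sum of sweeps
(part 9 of the Theorem-H1′ package; parts 1–8: `IntervalReaderSchur`, `IntervalReaderTransfer`,
`IntervalReaderH1`, `IntervalReaderBridge`, `IntervalReaderMoments`, `IntervalReaderWitness`,
`IntervalReaderAutomaton`, `IntervalReaderChainEnergy`)

HONEST FRAMING: first certified bounds; not a superconductivity verdict; every number certified or labelled
float.  Pure algebra (the Jordan–Wigner dictionary of the tree + part 6); no number is certified, no row moves.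

Part 8 did the open CHAIN, where the tree already had the product-operator form of `H`.  This file does every
Hubbard Hamiltonian `hamiltonian G t U` on a LINEARLY ORDERED finite vertex set (the Jordan–Wigner = reader
enumeration order), in particular the 2-D open BOXES of the FORMAT-mps1 rows read along their site enumeration:

* `hopFamily x y σ τ` — the product family of the hopping word `c†_{xσ} c_{yτ}` (`x ≠ y`): `c†_σ` at `x`, `c_τ` at
  `y`, the fermion parity `F` on every site `z` of the half-open string interval (`x ≤ z < y` or `y ≤ z < x` — the
  end `min x y` carries BOTH its ladder matrix and `F`, multiplied in that order), `1` elsewhere;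
  `toSpin_creation_mul_annihilation_eq_productOp` — `toSpin (c†_{xσ} c_{yτ}) = productOp (hopFamily x y σ τ)`
  (the tree's `toSpin_creation_mul_annihilation_of_lt/_of_gt`, Essler et al. §12.3.4, assembled into ONE product);
* `toSpin_hamiltonian_eq_sum_productOp` — `toSpin (hamiltonian G t U) = −t Σ_{x,y,σ} [G.Adj x y] ⨂ hopFamily x y σ σ`
  `+ U Σ_x ⨂ (n_↑n_↓ at x)`: a SUM OF PRODUCT OPERATORS for every finite graph `G`;
* `inner_toSpin_hamiltonian_mpsOpenVar` — hence, for a witness `ψ = mpsOpenVar N A l r` on `Fin N` and any graph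
  `G` on `Fin N`: `star ψ ⬝ᵥ (toSpin (hamiltonian G t U) ψ) = −t Σ_{x,y,σ} [G.Adj x y] S(hopFamily x y σ σ) + U Σ_x S(n_↑n_↓ at x)`
  with `S O = sweepPairing N A O l l r r` (part 8) — every term ONE one-state sweep of part 2's `transferOp`;
  `inner_toSpin_hamiltonian_add_mpsOpenVar` — the `t–t′` shape `hamiltonian G₁ t U + hamiltonian G₂ t′ U′`
  (nearest + next-nearest neighbour graphs), by additivity.

So for every FORMAT-mps1 model that is a (sum of) `hamiltonian G t U` on the enumeration order, BOTH sides of the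
certificate sentence `Re ⟨ψ, Hψ⟩ ≤ E · Re ⟨ψ, ψ⟩` are explicit finite contractions of the integer witness data (part 6
for the norm) — the quantities Theorem H1′ encloses and `accept_sound` compares.  Transport between a box's own
vertex type and `Fin N` (the enumeration) is the tree's Fock-relabelling business (`FockRelabel`,
`Theorems/R2cBoxMpsConsumer`), not repeated here; sourced / pair-field Hamiltonians are further sums of
two-fermion words and enter the same way once their dictionary entries are written (not done here).
-/

noncomputable section

open Matrix Finset
open scoped BigOperators ComplexOrder

namespace Summit.Ventures.CertifiedManyBodySolver.Upper.IntervalReader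

open Literature.MathematicalPhysics.QuantumLattice
open Literature.MathematicalPhysics.QuantumLattice.JordanWigner

/-! ## §P  Hopping words as single product operators -/

section Dictionary

variable {Λ : Type*} [LinearOrder Λ] [Fintype Λ]

/-- The product family of the hopping word `c†_{xσ} c_{yτ}` in the site-major Jordan–Wigner product basis:
at each site `z` the factor `[c†_σ if z = x] · [F if z lies in the half-open string interval from min to max) ·`
`[c_τ if z = y]` (all other factors `1`). -/
def hopFamily (x y : Λ) (σ τ : Fin 2) : Λ → Matrix (Fin 4) (Fin 4) ℂ := fun z =>
  Function.update (fun _ => (1 : Matrix (Fin 4) (Fin 4) ℂ)) x (siteCreation σ) z *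
    (if (x ≤ z ∧ z < y) ∨ (y ≤ z ∧ z < x) then siteParity else 1) *
      Function.update (fun _ => (1 : Matrix (Fin 4) (Fin 4) ℂ)) y (siteAnnihilation τ) z

/-- **A hopping word is ONE product operator.**  For `x ≠ y`:
`toSpin (c†_{xσ} c_{yτ}) = productOp (hopFamily x y σ τ)` (Essler et al. §12.3.4 (12.198)–(12.201), via the
tree's `toSpin_creation_mul_annihilation_of_lt` / `_of_gt`, `onSite_eq_productOp`, `productOp_mul`). -/
theorem toSpin_creation_mul_annihilation_eq_productOp {x y : Λ} (hxy : x ≠ y) (σ τ : Fin 2) :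
    toSpin (creation (orb x σ) * annihilation (orb y τ)) = productOp (hopFamily x y σ τ) := by
  rcases lt_or_gt_of_ne hxy with h | h
  · rw [toSpin_creation_mul_annihilation_of_lt h, onSite_eq_productOp, onSite_eq_productOp, productOp_mul,
      productOp_mul]
    congr 1
    funext z
    have hiff : ((x ≤ z ∧ z < y) ∨ (y ≤ z ∧ z < x)) ↔ (x ≤ z ∧ z < y) :=
      ⟨fun h' => h'.elim id fun h2 => absurd (lt_of_le_of_lt h2.1 h2.2) (lt_asymm h), Or.inl⟩
    simp only [hopFamily, hiff]
  · rw [toSpin_creation_mul_annihilation_of_gt h, onSite_eq_productOp, onSite_eq_productOp, productOp_mul,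
      productOp_mul]
    congr 1
    funext z
    have hiff : ((x ≤ z ∧ z < y) ∨ (y ≤ z ∧ z < x)) ↔ (y ≤ z ∧ z < x) :=
      ⟨fun h' => h'.elim (fun h1 => absurd (lt_of_le_of_lt h1.1 h1.2) (lt_asymm h)) id, Or.inr⟩
    simp only [hopFamily, hiff]

/-- **The Hubbard Hamiltonian of any finite graph is a sum of product operators** in the Jordan–Wigner product
basis of the (linearly ordered) vertex set: hopping words `⨂ hopFamily x y σ σ` over ordered adjacent pairs and
on-site `n_↑ n_↓`.  (The tree's `toSpin_hamiltonian`, term by term through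
`toSpin_creation_mul_annihilation_eq_productOp`; `G.Adj x y` forces `x ≠ y`.) -/
theorem toSpin_hamiltonian_eq_sum_productOp (G : SimpleGraph Λ) [DecidableRel G.Adj] (t U : ℝ) :
    toSpin (hamiltonian G t U) =
      -(t : ℂ) • (∑ x : Λ, ∑ y : Λ, ∑ σ : Fin 2,
          if G.Adj x y then productOp (hopFamily x y σ σ) else 0) +
        (U : ℂ) • ∑ x : Λ, productOp (Function.update (fun _ => (1 : Matrix (Fin 4) (Fin 4) ℂ)) x siteDouble) := by
  rw [toSpin_hamiltonian]
  congr 2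
  · refine Finset.sum_congr rfl fun x _ => Finset.sum_congr rfl fun y _ => Finset.sum_congr rfl fun σ _ => ?_
    by_cases hadj : G.Adj x y
    · rw [if_pos hadj, if_pos hadj, ← toSpin_creation_mul_annihilation,
        toSpin_creation_mul_annihilation_eq_productOp (G.ne_of_adj hadj)]
    · rw [if_neg hadj, if_neg hadj]
  · exact Finset.sum_congr rfl fun x _ => onSite_eq_productOp x _

end Dictionary

/-! ## §Q  The sandwich: every term is one sweep -/

variable {D : ℕ}

/-- **`⟨ψ|H|ψ⟩` of an MPS witness is a finite sum of one-state sweeps, for ANY finite graph.**  On the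
enumeration order `Fin N` (the reader's = the Jordan–Wigner order), for any graph `G` on `Fin N`, couplings
`t, U` and the witness `ψ = mpsOpenVar N A l r`:
`star ψ ⬝ᵥ (toSpin (hamiltonian G t U) *ᵥ ψ) = −t · Σ_{x,y,σ} [G.Adj x y] S (hopFamily x y σ σ) + U · Σ_x S (n_↑n_↓ at x)`,
`S O = sweepPairing N A O l l r r`. -/
theorem inner_toSpin_hamiltonian_mpsOpenVar (N : ℕ) (G : SimpleGraph (Fin N)) [DecidableRel G.Adj]
    (t U : ℝ) (A : Fin N → MPSTensor 4 D) (l r : Fin D → ℂ) :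
    star (mpsOpenVar N A l r) ⬝ᵥ (toSpin (hamiltonian G t U) *ᵥ mpsOpenVar N A l r) =
      -(t : ℂ) * (∑ x : Fin N, ∑ y : Fin N, ∑ σ : Fin 2,
          if G.Adj x y then sweepPairing N A (hopFamily x y σ σ) l l r r else 0) +
        (U : ℂ) * ∑ x : Fin N, sweepPairing N A
          (Function.update (fun _ => (1 : Matrix (Fin 4) (Fin 4) ℂ)) x siteDouble) l l r r := by
  rw [toSpin_hamiltonian_eq_sum_productOp, add_mulVec, dotProduct_add, smul_mulVec, smul_mulVec,
    dotProduct_smul, dotProduct_smul, smul_eq_mul, smul_eq_mul, Matrix.sum_mulVec, dotProduct_sum,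
    Matrix.sum_mulVec, dotProduct_sum]
  congr 2
  · refine Finset.sum_congr rfl fun x _ => ?_
    rw [Matrix.sum_mulVec, dotProduct_sum]
    refine Finset.sum_congr rfl fun y _ => ?_
    rw [Matrix.sum_mulVec, dotProduct_sum]
    refine Finset.sum_congr rfl fun σ _ => ?_
    by_cases hadj : G.Adj x y
    · rw [if_pos hadj, if_pos hadj, inner_productOp_mpsOpenVar]
    · rw [if_neg hadj, if_neg hadj, zero_mulVec, dotProduct_zero]
  · exact Finset.sum_congr rfl fun x _ => inner_productOp_mpsOpenVar N A _ l l r r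

/-- **The `t–t′` shape.**  For two graphs on the enumeration order (nearest and next-nearest neighbour bonds)
with couplings `(t, U)` and `(t′, U′)`: `⟨ψ, toSpin (hamiltonian G₁ t U + hamiltonian G₂ t′ U′) ψ⟩` is the sum of
the two sweep expansions of `inner_toSpin_hamiltonian_mpsOpenVar` (`toSpin` is additive, `mulVec`/`dotProduct`
are additive). -/
theorem inner_toSpin_hamiltonian_add_mpsOpenVar (N : ℕ) (G₁ G₂ : SimpleGraph (Fin N)) [DecidableRel G₁.Adj]
    [DecidableRel G₂.Adj] (t U t' U' : ℝ) (A : Fin N → MPSTensor 4 D) (l r : Fin D → ℂ) :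
    star (mpsOpenVar N A l r) ⬝ᵥ
        (toSpin (hamiltonian G₁ t U + hamiltonian G₂ t' U') *ᵥ mpsOpenVar N A l r) =
      (-(t : ℂ) * (∑ x : Fin N, ∑ y : Fin N, ∑ σ : Fin 2,
          if G₁.Adj x y then sweepPairing N A (hopFamily x y σ σ) l l r r else 0) +
        (U : ℂ) * ∑ x : Fin N, sweepPairing N A
          (Function.update (fun _ => (1 : Matrix (Fin 4) (Fin 4) ℂ)) x siteDouble) l l r r) +
      (-(t' : ℂ) * (∑ x : Fin N, ∑ y : Fin N, ∑ σ : Fin 2,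
          if G₂.Adj x y then sweepPairing N A (hopFamily x y σ σ) l l r r else 0) +
        (U' : ℂ) * ∑ x : Fin N, sweepPairing N A
          (Function.update (fun _ => (1 : Matrix (Fin 4) (Fin 4) ℂ)) x siteDouble) l l r r) := by
  rw [map_add, add_mulVec, dotProduct_add, inner_toSpin_hamiltonian_mpsOpenVar,
    inner_toSpin_hamiltonian_mpsOpenVar]

end Summit.Ventures.CertifiedManyBodySolver.Upper.IntervalReader

end
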